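import Mathlib.Analysis.SpecialFunctions.Log.Deriv
import Mathlib.Analysis.SpecialFunctions.Sqrt
import Mathlib.Analysis.SpecialFunctions.Pow.Real
import HarnessLib

/-!
# Pieces of Eliashberg's handle profile: the descending law, the convex region, the quadric tail

Topic `Literature/Geometry/Symplectic`; proofs file of the fact seat of
`Literature.Geometry.Symplectic.Gompf1998_thm13_twoHandles` (**E2**, `SteinTwoHandles.lean`),
continuing `SteinHandleProfileStart.lean`.  Eliashberg's handlebody (Eliashberg 1990,
Lemma 3.4.3 = Forstnerič–Kozak 2003, Prop. 3.1) `K = {|x| ≤ f⁻¹(|y|)} ⊂ ℂ²` is built on an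
increasing profile `u = f(t)` (`t = |x|`, `u = |y|`) which must satisfy the two inequalities
(3.2) of Forstnerič–Kozak, `f (f'' + f'³/t) > 1` and `f f'/t > 1`, and agree with the quadric
`g(t) = √(λt² + 1)` for `t ≥ ε`.  Forstnerič–Kozak take `f'` piecewise: `g'` (`t ≥ ε`), a line
(`η ≤ t < ε`, their Case 1), `c₁ + η log(η/t)` (`2σ ≤ t < η`, Case 2: *"`f'' (t) = -η/t` … we
obtain `f (f'' + f'³/t) - 1 > M(-η/t + c³/t) - 1 > 0`"*), `2√σ/√(t - σ)` (Case 3).  This file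
records, as pointwise lemmas to be assembled, the pieces of a `C^∞` variant:

* §1 `descSlope C η t = (C + log(t/η))^{-1/2}` — the **descending law** replacing Case 2: its
  derivative is *exactly* `-descSlope³/(2t)` (`hasDerivAt_descSlope`), so that
  `f'' + f'³/t = f'³/(2t)`; `descSlope C η η = C^{-1/2}` (`descSlope_self`), it is decreasing
  (`descSlope_antitone`), and `= 2` at `t₂ = η e^{-(C - 1/4)}` (`descSlope_junction`);
* §2 `region2_shape_ineq` — (3.2) in the descending region: if `f ≥ m > 0`, `0 < t ≤ η`,
  `f'' = -P³/(2t)` with `P ≥ c > 0`, `f' ≥ (9/10) P`, and `η < m c³/5`, `c ≤ 1`, then both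
  inequalities hold (Case 2 of Forstnerič–Kozak, with slack for the assembled profile);
* §3 `region1_shape_ineq` — (3.2) in the convex region (Case 1: *"`f (f'' + f'³/t) > f f''
  > g''(ε)/g(ε) > 1`"*): if `f A > 1`, `f'' ≥ A > 0`, `f' ≥ A t`, then both inequalities hold;
* §4 `quadric_shape_ineq` — (3.2) for the tail `g = √(λt² + 1)`, `λ > 1`, `t > 0`
  (Example 2.4: *"`g_{λ,a}` satisfies the reverse inequalities in (2.6) if `λ > 1`"*, here in
  the `|x|, |y|` form (3.2)): `g (g'' + g'³/t) = λ(1 + λ²t²)/(1 + λt²) ≥ λ` and `g g'/t = λ`,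
  with `hasDerivAt_quadric`, `hasDerivAt_deriv_quadric`.

Everything is **proved**; two definitions (`descSlope`, `quadric`), no named fact.

## References

* F. Forstnerič, J. Kozak, *Strongly pseudoconvex handlebodies*, J. Korean Math. Soc. 40
  (2003), 727–745 (arXiv:math/0305237), Example 2.4, Prop. 3.1 and its proof (Cases 1–3).
  [ForstnericKozak2003]
* Ya. Eliashberg, *Topological characterization of Stein manifolds of dimension > 2*,
  Internat. J. Math. 1 (1990), 29–46, Lemma 3.4.3. [Eliashberg1990Stein]
-/

noncomputable section

open Set Filter
open scoped Topology

namespace Literature.Geometry.Symplectic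

/-! ### §1 The descending law -/

/-- **The descending law** `P(t) = (C + log(t/η))^{-1/2}` for the slope `f'` on the region
`t ≤ η`, where `f'` must come down from `2` (at `t₂ = η e^{-(C-1/4)}`) to `C^{-1/2}` (at `η`)
as `t` increases. [cite: ForstnericKozak2003, Prop. 3.1] -/
def descSlope (C η t : ℝ) : ℝ := 1 / Real.sqrt (C + Real.log (t / η))

variable {C η : ℝ}

/-- `P > 0` where `C + log(t/η) > 0`. [folklore] -/
theorem descSlope_pos {t : ℝ} (hD : 0 < C + Real.log (t / η)) : 0 < descSlope C η t := by
  rw [descSlope]; exact div_pos one_pos (Real.sqrt_pos.2 hD)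

/-- `P(t)² = 1/(C + log(t/η))`. [folklore] -/
theorem descSlope_sq {t : ℝ} (hD : 0 < C + Real.log (t / η)) :
    descSlope C η t ^ 2 = 1 / (C + Real.log (t / η)) := by
  rw [descSlope, div_pow, one_pow, Real.sq_sqrt hD.le]

/-- `P(η) = C^{-1/2}` (`η > 0`). [cite: ForstnericKozak2003, Prop. 3.1] -/
theorem descSlope_self (hη : 0 < η) : descSlope C η η = 1 / Real.sqrt C := by
  rw [descSlope, div_self hη.ne', Real.log_one, add_zero]

/-- **`P = 2` at the junction `t₂ = η e^{-(C - 1/4)}`** with the start piece.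
[cite: ForstnericKozak2003, Prop. 3.1] -/
theorem descSlope_junction (hη : 0 < η) :
    descSlope C η (η * Real.exp (-(C - 1 / 4))) = 2 := by
  rw [descSlope, mul_comm, mul_div_assoc, div_self hη.ne', mul_one, Real.log_exp]
  have h : C + -(C - 1 / 4) = (1 / 2) ^ 2 := by norm_num
  rw [h, Real.sqrt_sq (by norm_num)]
  norm_num

/-- **`P` is decreasing**: for `0 < t₁ ≤ t₂` in the domain, `P(t₂) ≤ P(t₁)`. [folklore] -/
theorem descSlope_antitone (hη : 0 < η) {t₁ t₂ : ℝ} (ht₁ : 0 < t₁) (h12 : t₁ ≤ t₂)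
    (hD : 0 < C + Real.log (t₁ / η)) : descSlope C η t₂ ≤ descSlope C η t₁ := by
  have hlog : Real.log (t₁ / η) ≤ Real.log (t₂ / η) :=
    Real.log_le_log (div_pos ht₁ hη) (div_le_div_of_nonneg_right h12 hη.le)
  have hD2 : 0 < C + Real.log (t₂ / η) := by linarith
  rw [descSlope, descSlope]
  exact div_le_div_of_nonneg_left zero_le_one (Real.sqrt_pos.2 hD)
    (Real.sqrt_le_sqrt (by linarith))

/-- **`P' = -P³/(2t)`**: the derivative of `(C + log(t/η))^{-1/2}` at `t > 0` in the domain.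
[cite: ForstnericKozak2003, Prop. 3.1] -/
theorem hasDerivAt_descSlope (hη : 0 < η) {t : ℝ} (ht : 0 < t) (hD : 0 < C + Real.log (t / η)) :
    HasDerivAt (descSlope C η) (-(descSlope C η t ^ 3) / (2 * t)) t := by
  -- `D(t) = C + log(t/η)`, `D' = 1/t`
  have hDd : HasDerivAt (fun t => C + Real.log (t / η)) (1 / t) t := by
    have h1 : HasDerivAt (fun t => t / η) (1 / η) t := (hasDerivAt_id' t).div_const η
    have h2 := h1.log (div_pos ht hη).ne'
    have h3 := h2.const_add C
    refine h3.congr_deriv ?_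
    field_simp
  -- `√D` and its inverse
  have hsq : HasDerivAt (fun t => Real.sqrt (C + Real.log (t / η)))
      (1 / t / (2 * Real.sqrt (C + Real.log (t / η)))) t := hDd.sqrt hD.ne'
  have hS0 : Real.sqrt (C + Real.log (t / η)) ≠ 0 := (Real.sqrt_pos.2 hD).ne'
  have hinv := hsq.inv hS0
  have hinv' : HasDerivAt (descSlope C η)
      (-(1 / t / (2 * Real.sqrt (C + Real.log (t / η)))) / Real.sqrt (C + Real.log (t / η)) ^ 2) t :=
    hinv.congr_of_eventuallyEq (Eventually.of_forall fun t' => by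
      simp [descSlope, one_div])
  refine hinv'.congr_deriv ?_
  rw [descSlope]
  have hS2 : Real.sqrt (C + Real.log (t / η)) ^ 2 = C + Real.log (t / η) := Real.sq_sqrt hD.le
  field_simp

/-! ### §2 The inequalities (3.2) in the descending region -/

/-- **(3.2) in the descending region (Case 2 of Forstnerič–Kozak).**  At a point `0 < t ≤ η`
where `f ≥ m > 0`, `f'' = -P³/(2t)` for a value `P ≥ c > 0` of the descending law, and the
actual slope satisfies `f' ≥ (9/10) P` (slack for the assembled profile), the inequalities
`f (f'' + f'³/t) > 1` and `f f'/t > 1` hold as soon as `η < m c³/5` and `c ≤ 1`.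
[cite: ForstnericKozak2003, Prop. 3.1] -/
theorem region2_shape_ineq {f p P q t m c η : ℝ} (hm : 0 < m) (hf : m ≤ f) (ht : 0 < t)
    (htη : t ≤ η) (hc : 0 < c) (hc1 : c ≤ 1) (hP : c ≤ P) (hp : 9 / 10 * P ≤ p)
    (hq : q = -P ^ 3 / (2 * t)) (hη : η < m * c ^ 3 / 5) :
    1 < f * (q + p ^ 3 / t) ∧ 1 < f * p / t := by
  have hP0 : 0 < P := lt_of_lt_of_le hc hP
  have hp0 : 0 < p := by linarith
  have hf0 : 0 < f := lt_of_lt_of_le hm hf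
  have hη0 : 0 < η := lt_of_lt_of_le ht htη
  -- `p³ ≥ (9/10)³ P³`
  have hp3 : (9 / 10) ^ 3 * P ^ 3 ≤ p ^ 3 := by
    rw [← mul_pow]; exact pow_le_pow_left₀ (by positivity) hp 3
  have hc3 : c ^ 3 ≤ P ^ 3 := pow_le_pow_left₀ hc.le hP 3
  constructor
  · -- `q + p³/t ≥ (729/1000 - 1/2) P³/t ≥ 0.229 c³/η > 1.145/m`
    have h1 : (229 / 1000) * P ^ 3 / t ≤ q + p ^ 3 / t := by
      rw [hq]
      have : (229 / 1000) * P ^ 3 / t = -P ^ 3 / (2 * t) + (729 / 1000) * P ^ 3 / t := by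
        field_simp; ring
      rw [this]
      gcongr
      norm_num at hp3 ⊢
      linarith
    have h2 : (229 / 1000) * c ^ 3 / η ≤ (229 / 1000) * P ^ 3 / t := by
      gcongr
    have h3 : 1 < m * ((229 / 1000) * c ^ 3 / η) := by
      rw [mul_div_assoc', lt_div_iff₀ hη0]; nlinarith
    calc (1 : ℝ) < m * ((229 / 1000) * c ^ 3 / η) := h3
      _ ≤ f * (q + p ^ 3 / t) := mul_le_mul hf (h2.trans h1) (by positivity) hf0.le
  · -- `f p / t ≥ m (9/10) c / η > 1`
    have h1 : 1 < m * (9 / 10 * c) / η := by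
      rw [lt_div_iff₀ hη0]
      have hc3' : c ^ 3 ≤ c := by
        calc c ^ 3 = c * (c * c) := by ring
          _ ≤ c * (1 * 1) := by gcongr
          _ = c := by ring
      nlinarith
    calc (1 : ℝ) < m * (9 / 10 * c) / η := h1
      _ ≤ f * p / t := by
        gcongr
        · exact le_trans (by nlinarith) hp

/-! ### §3 The inequalities (3.2) in the convex region -/

/-- **(3.2) in the convex region (Case 1 of Forstnerič–Kozak).**  If `f A > 1`, `A > 0`,
`f'' ≥ A`, `f' ≥ A t` and `t > 0`, then `f (f'' + f'³/t) > 1` and `f f'/t > 1`.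
[cite: ForstnericKozak2003, Prop. 3.1] -/
theorem region1_shape_ineq {f p q t A : ℝ} (hA : 0 < A) (hfA : 1 < f * A) (hq : A ≤ q)
    (hp : A * t ≤ p) (ht : 0 < t) : 1 < f * (q + p ^ 3 / t) ∧ 1 < f * p / t := by
  have hf : 0 < f := by
    by_contra h
    have : f * A ≤ 0 := mul_nonpos_of_nonpos_of_nonneg (not_lt.1 h) hA.le
    linarith
  have hp0 : 0 < p := lt_of_lt_of_le (mul_pos hA ht) hp
  constructor
  · have h1 : A ≤ q + p ^ 3 / t := by
      have : 0 < p ^ 3 / t := by positivity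
      linarith
    calc (1 : ℝ) < f * A := hfA
      _ ≤ f * (q + p ^ 3 / t) := mul_le_mul_of_nonneg_left h1 hf.le
  · rw [lt_div_iff₀ ht]
    calc 1 * t < f * A * t := mul_lt_mul_of_pos_right hfA ht
      _ = f * (A * t) := by ring
      _ ≤ f * p := mul_le_mul_of_nonneg_left hp hf.le

/-! ### §4 The quadric tail -/

/-- **The quadric profile** `g(t) = √(λt² + 1)`: `{|y| ≥ g(|x|)} = D_λ = {|y|² ≥ λ|x|² + 1}`.
[cite: ForstnericKozak2003, Example 2.4] -/
def quadric (l t : ℝ) : ℝ := Real.sqrt (l * t ^ 2 + 1)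

variable {l : ℝ}

/-- `g > 0` (`λ ≥ 0`). [folklore] -/
theorem quadric_pos (hl : 0 ≤ l) (t : ℝ) : 0 < quadric l t :=
  Real.sqrt_pos.2 (by positivity)

/-- `g² = λt² + 1` (`λ ≥ 0`). [folklore] -/
theorem quadric_sq (hl : 0 ≤ l) (t : ℝ) : quadric l t ^ 2 = l * t ^ 2 + 1 :=
  Real.sq_sqrt (by positivity)

/-- **`g' = λt/g`.** [cite: ForstnericKozak2003, Prop. 3.1] -/
theorem hasDerivAt_quadric (hl : 0 ≤ l) (t : ℝ) :
    HasDerivAt (quadric l) (l * t / quadric l t) t := by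
  have h1 : HasDerivAt (fun t => l * t ^ 2 + 1) (l * (2 * t)) t := by
    have := ((hasDerivAt_id' t).pow 2).const_mul l
    simpa using this.add_const 1
  have h2 := h1.sqrt (by positivity : l * t ^ 2 + 1 ≠ 0)
  refine (h2.congr_of_eventuallyEq (Eventually.of_forall fun t' => rfl)).congr_deriv ?_
  rw [quadric]
  field_simp

/-- **`g'' = λ/g³`**: the derivative of `t ↦ λt/g(t)`. [cite: ForstnericKozak2003, Prop. 3.1] -/
theorem hasDerivAt_deriv_quadric (hl : 0 ≤ l) (t : ℝ) :
    HasDerivAt (fun t => l * t / quadric l t) (l / quadric l t ^ 3) t := by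
  have hg0 : quadric l t ≠ 0 := (quadric_pos hl t).ne'
  have h1 : HasDerivAt (fun t => l * t) l t := by
    simpa using (hasDerivAt_id' t).const_mul l
  have h2 := h1.div (hasDerivAt_quadric hl t) hg0
  refine h2.congr_deriv ?_
  have hsq := quadric_sq hl t
  field_simp
  rw [hsq]
  ring

/-- **(3.2) for the quadric tail** (`λ > 1`, `t > 0`):
`g (g'' + g'³/t) = λ(1 + λ²t²)/(1 + λt²) ≥ λ > 1` and `g g'/t = λ > 1`.
[cite: ForstnericKozak2003, Example 2.4] -/
theorem quadric_shape_ineq (hl : 1 < l) {t : ℝ} (ht : 0 < t) :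
    1 < quadric l t * (l / quadric l t ^ 3 + (l * t / quadric l t) ^ 3 / t) ∧
      1 < quadric l t * (l * t / quadric l t) / t := by
  have hl0 : 0 ≤ l := by linarith
  set g := quadric l t with hg
  have hg0 : 0 < g := quadric_pos hl0 t
  have hsq : g ^ 2 = l * t ^ 2 + 1 := quadric_sq hl0 t
  constructor
  · have h1 : g * (l / g ^ 3 + (l * t / g) ^ 3 / t) = l * (1 + l ^ 2 * t ^ 2) / g ^ 2 := by
      field_simp
    rw [h1, lt_div_iff₀ (by positivity), hsq]
    have h2 : l * (1 + l ^ 2 * t ^ 2) - 1 * (l * t ^ 2 + 1) = (l - 1) * (1 + l * (l + 1) * t ^ 2) := by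
      ring
    have h3 : 0 < (l - 1) * (1 + l * (l + 1) * t ^ 2) := mul_pos (by linarith) (by positivity)
    linarith
  · have h1 : g * (l * t / g) / t = l := by field_simp
    rw [h1]; exact hl

end Literature.Geometry.Symplectic

end
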